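import Literature.NumberTheory.Transcendental.NesterenkoLocalUnmixed
import Literature.NumberTheory.Transcendental.NesterenkoElimination
import Literature.RingTheory.MvPolynomial.HomogeneousDimension
import Literature.RingTheory.MvPolynomial.HomogeneousHilbertFunction
import Literature.RingTheory.GradedAlgebra.HomogeneousAssociatedPrimes
import Mathlib.RingTheory.Ideal.AssociatedPrime.Finiteness
import Mathlib.RingTheory.Ideal.AssociatedPrime.Localization
import Mathlib.RingTheory.Regular.RegularSequence
import HarnessLib

/-!
# Complete intersections of dimension zero in `ℙ³`, I: Macaulay, a linear non-zero-divisor, Hilbert arithmetic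
# (crux `stmt-Schanuel-6117`, stub `CycleAPIAt3`, elimination-theoretic line — helper file)

Crux `stmt-Schanuel-6117` (`Summit.Schanuel.Schanuel.Theses.DiophantineDichotomy.ApproximationProperty`),
route `DiophantineDichotomy`, line `orbit-interpolation-determinant`, stub `CycleAPIAt3 : CycleAPIAt 3`
(siege attempt k = 21, variation "elimination-theoretic"). Everything here is PROVED; no definitions,
no named facts. This file and its sequel `…ElimCISpace.lean` are the `ℙ³` analogue of the landed plane
statements `stub_ciDecomposition` / `stub_ciInterpolation` (files `…CIDecomposition.lean`,
`…CIInterpolation.lean`), one hypersurface section further; they are consumed twice by the `t = 3`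
descent — (i) for the interpolation clause of orbits lying on a `0`-dimensional complete intersection
`V(Q) ∩ V(P) ∩ V(T)` of `ℙ³`, and (ii) with `T = ℓ` a linear form, for the growth of the Hilbert
function of a curve `𝔭 ⊇ (Q, P)` through its hyperplane sections
(`H(𝔭; ν) − H(𝔭; ν−1) = H(𝔭 + (ℓ); ν) ≥ #(V(𝔭) ∩ V(ℓ))` from degree `a + b + 1` on).

Let `S = ℚ[x₀, …, x₃]` (`Rx 3`), `Q ≠ 0` a form of degree `a ≥ 1` generating a prime ideal,
`P ∉ (Q)` a form of degree `b ≥ 1`, `T` a form of degree `τ ≥ 1` which is a non-zero-divisor modulo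
`(Q, P)`.

* `ElimCISpace.decomp_step`, `ElimCISpace.decomp` — `S_{s+N} = L^N S_s + (Q, P, T)_{s+N}` from
  `(Q, P, T, L)_{n+1} = S_{n+1}` (`n ≥ s`), any forms `Q, P, T`, any number of variables.
* `ElimCISpace.ringKrullDim_quotient_eq_one` — Macaulay's unmixedness at the irrelevant prime for
  the avoiding sequence `[Q, P, T]` (tree
  `Nesterenko.ringKrullDim_quotient_eq_of_mem_associatedPrimes_of_avoids`, `m = 3`): the associated
  primes of `(Q, P, T)` have `dim = 1`.
* `ElimCISpace.exists_linearForm` — a linear non-zero-divisor modulo `(Q, P, T)` outside any finite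
  family of ideals each missing some linear form (prime avoidance in `S₁`).
* `ElimCISpace.hilbert_arith` — the arithmetic of four hypersurface-section formulas: the vanishing
  of the third difference of the quadratic `n ↦ C(n+2, 2) = dim S_n − dim S_{n−1}`
  (`ElimCISpace.choose_cube`).
* `elim_ciSpaceLemmas` — Macaulay + the linear non-zero-divisor, packaged (registered helper).

Sources: Nesterenko–Philippon (eds.), LNM 1752, Ch. 10 §3 (Macaulay) and Ch. 11 §2.2 (Hilbert
functions of hypersurface sections); Philippon, Bull. SMF 114 (1986), Lemme 3.1.
-/

set_option linter.dupNamespace false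

noncomputable section

namespace Summit.Schanuel.Schanuel.Cruxes.ApproximationProperty.OrbitInterpolationDeterminant

open Literature.NumberTheory.Transcendental.Nesterenko MvPolynomial Module
open Literature.RingTheory.MvPolynomial

namespace ElimCISpace

variable {m : ℕ}

/-! ## Generalities (any number of variables) -/

/-- A form of positive degree lies in the irrelevant ideal `ker constantCoeff`. [folklore] -/
theorem mem_ker_constantCoeff_of_isHomogeneous {F : Rx m} {n : ℕ} (hF : F.IsHomogeneous n)
    (hn : 1 ≤ n) : F ∈ RingHom.ker (constantCoeff : Rx m →+* ℚ) := by
  rw [RingHom.mem_ker, constantCoeff_eq]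
  exact hF.coeff_eq_zero (by rw [map_zero]; omega)

/-- `span {F}` is a homogeneous ideal for a form `F`. [folklore] -/
theorem isHomogeneous_span [GradedAlgebra (homogeneousSubmodule (Fin (m + 1)) ℚ)] {F : Rx m}
    {n : ℕ} (hF : F.IsHomogeneous n) :
    (Ideal.span {F}).IsHomogeneous (homogeneousSubmodule (Fin (m + 1)) ℚ) :=
  Ideal.homogeneous_span _ _ fun x hx => ⟨n, by rw [Set.mem_singleton_iff.mp hx]; exact hF⟩

/-- A minimal prime of `I` is an associated prime of `S ⧸ I` (Noetherian `S`). [folklore] -/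
theorem mem_associatedPrimes_of_mem_minimalPrimes {R : Type*} [CommRing R] [IsNoetherianRing R]
    {I 𝔭 : Ideal R} (h𝔭 : 𝔭 ∈ I.minimalPrimes) : 𝔭 ∈ associatedPrimes R (R ⧸ I) := by
  have h := Module.associatedPrimes.minimalPrimes_annihilator_subset_associatedPrimes
    (R := R) (M := R ⧸ I)
  rw [Ideal.annihilator_quotient] at h
  exact h h𝔭

/-- A non-zero-divisor modulo `I` lies in no associated prime of `S ⧸ I`. [folklore] -/
theorem notMem_of_mem_associatedPrimes_of_nzd {R : Type*} [CommRing R] [IsNoetherianRing R]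
    {I 𝔭 : Ideal R} {T : R}
    (hT : ∀ f, T * f ∈ I → f ∈ I) (h𝔭 : 𝔭 ∈ associatedPrimes R (R ⧸ I)) : T ∉ 𝔭 := by
  intro hT𝔭
  have hmem : T ∈ ⋃ p ∈ associatedPrimes R (R ⧸ I), (p : Set R) := Set.mem_biUnion h𝔭 hT𝔭
  rw [biUnion_associatedPrimes_eq_zero_divisors] at hmem
  obtain ⟨x, hx0, hx⟩ := hmem
  obtain ⟨f, rfl⟩ := Ideal.Quotient.mk_surjective x
  apply hx0
  rw [Ideal.Quotient.eq_zero_iff_mem]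
  apply hT
  rw [Algebra.smul_def, Ideal.Quotient.algebraMap_eq, ← map_mul, Ideal.Quotient.eq_zero_iff_mem] at hx
  exact hx

/-- One step of the graded decomposition: if `(Q, P, T, L)_{n+1} = S_{n+1}` for forms `Q, P, T`
and a linear form `L`, every form of degree `n + 1` is `L G` modulo `(Q, P, T)` with `G` a form of
degree `n` (any number of variables). [folklore] -/
theorem decomp_step {Q P T L : Rx m} {a b τ : ℕ} (hQ : Q.IsHomogeneous a) (hP : P.IsHomogeneous b)
    (hTτ : T.IsHomogeneous τ) (hL1 : L.IsHomogeneous 1) {n : ℕ}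
    (hfull : idealDegree (Ideal.span {Q} ⊔ Ideal.span {P} ⊔ Ideal.span {T} ⊔ Ideal.span {L}) (n + 1) =
      homogeneousSubmodule (Fin (m + 1)) ℚ (n + 1))
    {F : Rx m} (hF : F.IsHomogeneous (n + 1)) :
    ∃ G : Rx m, G.IsHomogeneous n ∧ F - L * G ∈ Ideal.span {Q} ⊔ Ideal.span {P} ⊔ Ideal.span {T} := by
  letI : GradedAlgebra (homogeneousSubmodule (Fin (m + 1)) ℚ) := MvPolynomial.gradedAlgebra
  have hJ : (Ideal.span {Q} ⊔ Ideal.span {P} ⊔ Ideal.span {T}).IsHomogeneous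
      (homogeneousSubmodule (Fin (m + 1)) ℚ) :=
    ((isHomogeneous_span hQ).sup (isHomogeneous_span hP)).sup (isHomogeneous_span hTτ)
  have hF' : F ∈ idealDegree (Ideal.span {Q} ⊔ Ideal.span {P} ⊔ Ideal.span {T} ⊔ Ideal.span {L})
      (n + 1) := by
    rw [hfull]
    exact hF
  rw [idealDegree_sup_span_singleton hJ hL1 n] at hF'
  obtain ⟨j, hj, g, hg, hsum⟩ := Submodule.mem_sup.mp hF'
  obtain ⟨G, hG, rfl⟩ := Submodule.mem_map.mp hg
  refine ⟨G, hG, ?_⟩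
  have : F - L * G = j := by
    rw [← hsum, LinearMap.mulLeft_apply, add_sub_cancel_right]
  rw [this]
  exact (mem_idealDegree.mp hj).1

/-- Induction on `N`: if `(Q, P, T, L)_{n+1} = S_{n+1}` for all `n ≥ s`, every form of degree
`s + N` is `L^N G` modulo `(Q, P, T)` with `G` a form of degree `s`. [folklore] -/
theorem decomp {Q P T L : Rx m} {a b τ : ℕ} (hQ : Q.IsHomogeneous a) (hP : P.IsHomogeneous b)
    (hTτ : T.IsHomogeneous τ) (hL1 : L.IsHomogeneous 1) {s : ℕ}
    (hfull : ∀ n, s ≤ n →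
      idealDegree (Ideal.span {Q} ⊔ Ideal.span {P} ⊔ Ideal.span {T} ⊔ Ideal.span {L}) (n + 1) =
        homogeneousSubmodule (Fin (m + 1)) ℚ (n + 1)) :
    ∀ (N : ℕ) (F : Rx m), F.IsHomogeneous (s + N) →
      ∃ G : Rx m, G.IsHomogeneous s ∧ F - L ^ N * G ∈ Ideal.span {Q} ⊔ Ideal.span {P} ⊔ Ideal.span {T} := by
  intro N
  induction N with
  | zero =>
    intro F hF
    exact ⟨F, by simpa using hF, by simp⟩
  | succ N ih =>
    intro F hF
    obtain ⟨G₁, hG₁, h₁⟩ := decomp_step hQ hP hTτ hL1 (hfull (s + N) (Nat.le_add_right s N)) hF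
    obtain ⟨G, hG, h⟩ := ih G₁ hG₁
    refine ⟨G, hG, ?_⟩
    have : F - L ^ (N + 1) * G = (F - L * G₁) + L * (G₁ - L ^ N * G) := by ring
    rw [this]
    exact Ideal.add_mem _ h₁ (Ideal.mul_mem_left _ L h)

/-! ## Macaulay: the associated primes of `(Q, P)` and `(Q, P, T)` in `ℚ[x₀, …, x₃]` -/

section Space

variable {Q P T : Rx 3} {a b τ : ℕ}

/-- The avoidance property of the sequence `[Q, P, T]`: `Q ≠ 0`, `P ∉ (Q)` with `(Q)` prime, and
`T` a non-zero-divisor modulo `(Q, P)` lies in no minimal prime of `(Q, P)`. [folklore] -/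
theorem avoids (hQ0 : Q ≠ 0) (hprime : (Ideal.span {Q}).IsPrime) (hPQ : P ∉ Ideal.span {Q})
    (hT : ∀ f, T * f ∈ Ideal.span {Q} ⊔ Ideal.span {P} → f ∈ Ideal.span {Q} ⊔ Ideal.span {P})
    (𝔪 : Ideal (Rx 3)) :
    ∀ (L₁ : List (Rx 3)) (e : Rx 3) (L₂ : List (Rx 3)), [Q, P, T] = L₁ ++ e :: L₂ →
      ∀ 𝔮 ∈ (Ideal.ofList L₁).minimalPrimes, 𝔮 ≤ 𝔪 → e ∉ 𝔮 := by
  intro L₁ e L₂ hsplit 𝔮 h𝔮 _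
  rcases L₁ with _ | ⟨x, _ | ⟨y, _ | ⟨z, L₁'⟩⟩⟩
  · -- `e = Q`
    rw [List.nil_append] at hsplit
    obtain ⟨hQe, -⟩ := List.cons_eq_cons.mp hsplit
    rw [Ideal.ofList_nil, Ideal.minimalPrimes_eq_subsingleton_self, Set.mem_singleton_iff] at h𝔮
    rw [← hQe, h𝔮, Ideal.mem_bot]
    exact hQ0
  · -- `e = P`
    rw [List.singleton_append] at hsplit
    obtain ⟨hQx, hrest⟩ := List.cons_eq_cons.mp hsplit
    obtain ⟨hPe, -⟩ := List.cons_eq_cons.mp hrest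
    rw [← hQx, Ideal.ofList_singleton] at h𝔮
    haveI := hprime
    rw [Ideal.minimalPrimes_eq_subsingleton_self, Set.mem_singleton_iff] at h𝔮
    rw [← hPe, h𝔮]
    exact hPQ
  · -- `e = T`
    have hsplit' : [Q, P, T] = [x, y] ++ e :: L₂ := hsplit
    simp only [List.cons_append, List.nil_append, List.cons.injEq] at hsplit'
    obtain ⟨rfl, rfl, rfl, -⟩ := hsplit'
    have hE : Ideal.ofList [Q, P] = Ideal.span {Q} ⊔ Ideal.span {P} := by
      rw [Ideal.ofList_cons, Ideal.ofList_singleton]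
    rw [hE] at h𝔮
    exact notMem_of_mem_associatedPrimes_of_nzd hT (mem_associatedPrimes_of_mem_minimalPrimes h𝔮)
  · have := congrArg List.length hsplit
    simp only [List.length_cons, List.length_append, List.length_nil] at this
    omega

/-- **Macaulay's unmixedness for a complete intersection of `ℙ³`.** With `Q, P, T` as above
(degrees `a, b, τ ≥ 1`), every associated prime `𝔯` of `S/(Q, P, T)`, `S = ℚ[x₀, …, x₃]`, has
`dim S/𝔯 = 1`. [cite: NesterenkoPhilippon2001, Ch. 10 §3, proof of Prop. 3.6] -/
theorem ringKrullDim_quotient_eq_one (hQ0 : Q ≠ 0) (hQ : Q.IsHomogeneous a)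
    (hP : P.IsHomogeneous b) (hTτ : T.IsHomogeneous τ) (ha : 1 ≤ a) (hb : 1 ≤ b) (hτ : 1 ≤ τ)
    (hprime : (Ideal.span {Q}).IsPrime) (hPQ : P ∉ Ideal.span {Q})
    (hT : ∀ f, T * f ∈ Ideal.span {Q} ⊔ Ideal.span {P} → f ∈ Ideal.span {Q} ⊔ Ideal.span {P})
    {𝔯 : Ideal (Rx 3)}
    (h𝔯 : 𝔯 ∈ associatedPrimes (Rx 3)
      (Rx 3 ⧸ (Ideal.span {Q} ⊔ Ideal.span {P} ⊔ Ideal.span {T}))) :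
    ringKrullDim (Rx 3 ⧸ 𝔯) = (1 : ℕ) := by
  have hE : Ideal.ofList [Q, P, T] = Ideal.span {Q} ⊔ Ideal.span {P} ⊔ Ideal.span {T} := by
    rw [Ideal.ofList_cons, Ideal.ofList_cons, Ideal.ofList_singleton, sup_assoc]
  rw [← hE] at h𝔯
  have h𝔯' := (mem_associatedPrimes_quotient_iff _ _).mp h𝔯
  set 𝔪 : Ideal (Rx 3) := RingHom.ker (constantCoeff : Rx 3 →+* ℚ)
  haveI : 𝔪.IsPrime := isMaximal_ker_constantCoeff.isPrime
  have hE𝔪 : ∀ e ∈ [Q, P, T], e ∈ 𝔪 := by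
    intro e he
    simp only [List.mem_cons, List.not_mem_nil, or_false] at he
    rcases he with rfl | rfl | rfl
    · exact mem_ker_constantCoeff_of_isHomogeneous hQ ha
    · exact mem_ker_constantCoeff_of_isHomogeneous hP hb
    · exact mem_ker_constantCoeff_of_isHomogeneous hTτ hτ
  letI : GradedAlgebra (homogeneousSubmodule (Fin (3 + 1)) ℚ) := MvPolynomial.gradedAlgebra
  have hJhom : (Ideal.ofList [Q, P, T]).IsHomogeneous (homogeneousSubmodule (Fin (3 + 1)) ℚ) := by
    rw [hE]
    exact ((isHomogeneous_span hQ).sup (isHomogeneous_span hP)).sup (isHomogeneous_span hTτ)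
  have h𝔯hom := Literature.RingTheory.GradedAlgebra.isHomogeneous_of_mem_associatedPrimes
    (homogeneousSubmodule (Fin (3 + 1)) ℚ) hJhom h𝔯'
  have h𝔯𝔪 : 𝔯 ≤ 𝔪 :=
    le_ker_constantCoeff_of_isHomogeneous h𝔯hom (IsAssociatedPrime.isPrime h𝔯).ne_top
  have h := (ringKrullDim_quotient_eq_of_mem_associatedPrimes_of_avoids (m := 3) 𝔪 hE𝔪
    (avoids hQ0 hprime hPQ hT 𝔪) h𝔯' h𝔯𝔪).2.2
  rw [h]
  rfl

/-! ## A linear non-zero-divisor modulo `(Q, P, T)` avoiding a finite family -/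

/-- **Prime avoidance by a linear form**: under the hypotheses of `ringKrullDim_quotient_eq_one`
and for a finite family `𝓕` of ideals each missing some linear form, there is a linear form `L ≠ 0`
outside every member of `𝓕` which is a non-zero-divisor modulo `(Q, P, T)` (it also avoids the
finitely many associated primes of `S/(Q, P, T)`, none of which contains all linear forms since
each has `dim = 1 ≠ 0`). [cite: NesterenkoPhilippon2001, Ch. 11, proof of Prop. 2.2] -/
theorem exists_linearForm (hQ0 : Q ≠ 0) (hQ : Q.IsHomogeneous a)
    (hP : P.IsHomogeneous b) (hTτ : T.IsHomogeneous τ) (ha : 1 ≤ a) (hb : 1 ≤ b) (hτ : 1 ≤ τ)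
    (hprime : (Ideal.span {Q}).IsPrime) (hPQ : P ∉ Ideal.span {Q})
    (hT : ∀ f, T * f ∈ Ideal.span {Q} ⊔ Ideal.span {P} → f ∈ Ideal.span {Q} ⊔ Ideal.span {P})
    (𝓕 : Finset (Ideal (Rx 3))) (h𝓕 : ∀ 𝔮 ∈ 𝓕, ∃ L : Rx 3, L.IsHomogeneous 1 ∧ L ∉ 𝔮) :
    ∃ L : Rx 3, L.IsHomogeneous 1 ∧ (∀ 𝔮 ∈ 𝓕, L ∉ 𝔮) ∧ L ≠ 0 ∧
      ∀ f, L * f ∈ Ideal.span {Q} ⊔ Ideal.span {P} ⊔ Ideal.span {T} →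
        f ∈ Ideal.span {Q} ⊔ Ideal.span {P} ⊔ Ideal.span {T} := by
  classical
  set J₀ : Ideal (Rx 3) := Ideal.span {Q} ⊔ Ideal.span {P} ⊔ Ideal.span {T}
  have hfin := associatedPrimes.finite (Rx 3) (Rx 3 ⧸ J₀)
  have hP' : ∀ 𝔭 ∈ 𝓕 ∪ hfin.toFinset, ∃ i, (X i : Rx 3) ∉ 𝔭 := by
    intro 𝔭 h𝔭
    rcases Finset.mem_union.mp h𝔭 with h𝔭 | h𝔭
    · obtain ⟨L₀, hL₀1, hL₀𝔮⟩ := h𝓕 𝔭 h𝔭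
      by_contra hcon
      push Not at hcon
      exact hL₀𝔮 (ker_constantCoeff_le_of_forall_X_mem hcon
        (mem_ker_constantCoeff_of_isHomogeneous hL₀1 le_rfl))
    · have h𝔯 := hfin.mem_toFinset.mp h𝔭
      haveI : 𝔭.IsPrime := IsAssociatedPrime.isPrime h𝔯
      refine exists_X_notMem_of_ringKrullDim_ne_zero ?_
      rw [ringKrullDim_quotient_eq_one hQ0 hQ hP hTτ ha hb hτ hprime hPQ hT h𝔯]
      norm_num
  obtain ⟨L, hL1, hL0, hL⟩ := exists_linearForm_forall_notMem (K := ℚ) (m := 3 + 1)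
    (Nat.succ_pos 3) (𝓕 ∪ hfin.toFinset) hP'
  refine ⟨L, hL1, fun 𝔮 h𝔮 => hL 𝔮 (Finset.mem_union_left _ h𝔮), hL0, fun f hf => ?_⟩
  by_contra hfJ
  have hmk : Ideal.Quotient.mk J₀ f ≠ 0 := mt Ideal.Quotient.eq_zero_iff_mem.mp hfJ
  have hzero : L • Ideal.Quotient.mk J₀ f = 0 := by
    rw [Algebra.smul_def, Ideal.Quotient.algebraMap_eq, ← map_mul,
      Ideal.Quotient.eq_zero_iff_mem]
    exact hf
  have hmem : L ∈ {r : Rx 3 | ∃ x : Rx 3 ⧸ J₀, x ≠ 0 ∧ r • x = 0} := ⟨_, hmk, hzero⟩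
  rw [← biUnion_associatedPrimes_eq_zero_divisors] at hmem
  obtain ⟨𝔯, h𝔯, hL𝔯⟩ := Set.mem_iUnion₂.mp hmem
  exact hL 𝔯 (Finset.mem_union_right _ (hfin.mem_toFinset.mpr h𝔯)) hL𝔯

/-! ## Hilbert-function bookkeeping -/

/-- Twice the binomial `C(n+3, 2)` is `(n+3)(n+2)`. [folklore] -/
theorem two_mul_choose (n : ℕ) : 2 * (n + 3).choose 2 = (n + 3) * (n + 2) := by
  have h := Nat.add_one_mul_choose_eq (n + 2) 1
  rw [Nat.choose_one_right] at h
  have h' : (n + 3) * (n + 2) = (n + 3).choose 2 * 2 := h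
  omega

/-- The third difference of the quadratic `n ↦ C(n+3, 2)` vanishes (cube identity at the eight
vertices `v + ε₁ a + ε₂ b + ε₃ τ`). [folklore] -/
theorem choose_cube (v a b τ : ℕ) :
    (v + a + b + τ + 3).choose 2 + (v + τ + 3).choose 2 + (v + b + 3).choose 2 +
        (v + a + 3).choose 2 =
      (v + b + τ + 3).choose 2 + (v + a + τ + 3).choose 2 + (v + a + b + 3).choose 2 +
        (v + 3).choose 2 := by
  have key : ∀ n : ℕ, 2 * (n + 3).choose 2 = (n + 3) * (n + 2) := two_mul_choose
  have h1 := key (v + a + b + τ)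
  have h2 := key (v + τ)
  have h3 := key (v + b)
  have h4 := key (v + a)
  have h5 := key (v + b + τ)
  have h6 := key (v + a + τ)
  have h7 := key (v + a + b)
  have h8 := key v
  nlinarith [h1, h2, h3, h4, h5, h6, h7, h8]

/-- Pascal's rule for `dim S_n = C(n + 3, 3)`: `dim S_{n+1} = dim S_n + C(n+3, 2)`. [folklore] -/
theorem finrank_homogeneousSubmodule_succ (n : ℕ) :
    finrank ℚ (homogeneousSubmodule (Fin (3 + 1)) ℚ (n + 1)) =
      finrank ℚ (homogeneousSubmodule (Fin (3 + 1)) ℚ n) + (n + 3).choose 2 := by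
  rw [Literature.RingTheory.HilbertSamuel.finrank_homogeneousSubmodule_fin,
    Literature.RingTheory.HilbertSamuel.finrank_homogeneousSubmodule_fin,
    show n + 1 + (3 + 1) - 1 = n + 3 + 1 by omega, show n + (3 + 1) - 1 = n + 3 by omega]
  have h1 : (n + 3 + 1).choose (n + 1) = (n + 3).choose n + (n + 3).choose (n + 1) :=
    Nat.choose_succ_succ (n + 3) n
  have h2 : (n + 3).choose (n + 1) = (n + 3).choose 2 := by
    rw [show n + 3 = (n + 1) + 2 by omega, Nat.choose_symm_add]
  omega

/-- The arithmetic of the four hypersurface sections: with `d (n+1) = d n + C(n+3, 2)` (Pascal),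
`q (t + a) = d t` (the section `(0) + (Q)`), `j (t + b) + q t = q (t + b) + d t` (the section
`(Q) + (P)`), `k (t + τ) + j t = j (t + τ) + d t` (the section `(Q, P) + (T)`) and
`kl (s+1) + k s = k (s+1) + d s` (the section `(Q, P, T) + (L)`), one gets `kl (s + 1) = d (s + 1)`
for `s ≥ a + b + τ`. [folklore] -/
theorem hilbert_arith {d q j k kl : ℕ → ℕ} {a b τ s : ℕ} (hs : a + b + τ ≤ s)
    (hd : ∀ n, d (n + 1) = d n + (n + 3).choose 2)
    (hq : ∀ t n, n = t + a → q n = d t)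
    (hj : ∀ t n, n = t + b → j n + q t = q n + d t)
    (hk : ∀ t n, n = t + τ → k n + j t = j n + d t)
    (hkl : kl (s + 1) + k s = k (s + 1) + d s) :
    kl (s + 1) = d (s + 1) := by
  obtain ⟨v, rfl⟩ : ∃ v, s = v + a + b + τ := ⟨s - a - b - τ, by omega⟩
  -- `k` at `s + 1` and `s`
  have k1 := hk (v + a + b + 1) (v + a + b + τ + 1) (by omega)
  have k2 := hk (v + a + b) (v + a + b + τ) rfl
  -- `j` at `s + 1`, `s`, `v + a + b + 1`, `v + a + b`
  have j1 := hj (v + a + τ + 1) (v + a + b + τ + 1) (by omega)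
  have j2 := hj (v + a + τ) (v + a + b + τ) (by omega)
  have j3 := hj (v + a + 1) (v + a + b + 1) (by omega)
  have j4 := hj (v + a) (v + a + b) rfl
  -- `q` at eight points
  have q1 := hq (v + b + τ + 1) (v + a + b + τ + 1) (by omega)
  have q2 := hq (v + b + τ) (v + a + b + τ) (by omega)
  have q3 := hq (v + τ + 1) (v + a + τ + 1) (by omega)
  have q4 := hq (v + τ) (v + a + τ) (by omega)
  have q5 := hq (v + b + 1) (v + a + b + 1) (by omega)
  have q6 := hq (v + b) (v + a + b) (by omega)
  have q7 := hq (v + 1) (v + a + 1) (by omega)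
  have q8 := hq v (v + a) rfl
  -- Pascal at eight points
  have p1 := hd (v + a + b + τ)
  have p2 := hd (v + b + τ)
  have p3 := hd (v + a + τ)
  have p4 := hd (v + a + b)
  have p5 := hd (v + τ)
  have p6 := hd (v + b)
  have p7 := hd (v + a)
  have p8 := hd v
  have cube := choose_cube v a b τ
  omega

end Space

end ElimCISpace

/-- **Complete intersections of dimension `0` in `ℙ³`, I** (crux `stmt-Schanuel-6117`, stub
`CycleAPIAt3`; registered helper `elim_ciSpaceLemmas`). Let `Q ≠ 0` be a form of degree `a ≥ 1` of
`ℚ[x₀, …, x₃]` generating a prime ideal, `P ∉ (Q)` a form of degree `b ≥ 1`, `T` a form of degree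
`τ ≥ 1` which is a non-zero-divisor modulo `(Q, P)`. Then (Macaulay) every associated prime of
`S/(Q, P, T)` has `dim = 1`, and for every finite family of ideals each missing a linear form there is a
linear form `L ≠ 0` outside all of them which is a non-zero-divisor modulo `(Q, P, T)`.
[cite: NesterenkoPhilippon2001, Ch. 10 §3 (proof of Prop. 3.6), Ch. 11 (proof of Prop. 2.2)] -/
theorem elim_ciSpaceLemmas : ∀ (Q P T : Rx 3) (a b τ : ℕ), Q ≠ 0 → Q.IsHomogeneous a → P.IsHomogeneous b → T.IsHomogeneous τ → 1 ≤ a → 1 ≤ b → 1 ≤ τ → (Ideal.span {Q}).IsPrime → P ∉ Ideal.span {Q} → (∀ f, T * f ∈ Ideal.span {Q} ⊔ Ideal.span {P} → f ∈ Ideal.span {Q} ⊔ Ideal.span {P}) → (∀ 𝔯 ∈ associatedPrimes (Rx 3) (Rx 3 ⧸ (Ideal.span {Q} ⊔ Ideal.span {P} ⊔ Ideal.span {T})), ringKrullDim (Rx 3 ⧸ 𝔯) = (1 : ℕ)) ∧ ∀ 𝓕 : Finset (Ideal (Rx 3)), (∀ 𝔮 ∈ 𝓕, ∃ L : Rx 3,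 L.IsHomogeneous 1 ∧ L ∉ 𝔮) → ∃ L : Rx 3, L.IsHomogeneous 1 ∧ (∀ 𝔮 ∈ 𝓕, L ∉ 𝔮) ∧ L ≠ 0 ∧ ∀ f, L * f ∈ Ideal.span {Q} ⊔ Ideal.span {P} ⊔ Ideal.span {T} → f ∈ Ideal.span {Q} ⊔ Ideal.span {P} ⊔ Ideal.span {T} := by
  intro Q P T a b τ hQ0 hQ hP hTτ ha hb hτ hprime hPQ hT
  exact ⟨fun 𝔯 h𝔯 => ElimCISpace.ringKrullDim_quotient_eq_one hQ0 hQ hP hTτ ha hb hτ hprime hPQ hT h𝔯,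
    fun 𝓕 h𝓕 => ElimCISpace.exists_linearForm hQ0 hQ hP hTτ ha hb hτ hprime hPQ hT 𝓕 h𝓕⟩

end Summit.Schanuel.Schanuel.Cruxes.ApproximationProperty.OrbitInterpolationDeterminant

end
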